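import Summits.BirchSwinnertonDyer.Rank1Residual.Additive.XGordRankZeroCyclotomicPrimeFacts
import HarnessLib

/-!
# Line V19, certificate form: `BSD(W,p) ∧ BSD(V,p)` from the named facts and ONE per-pair numerical
# certificate including the Tamagawa exponent over `ℚ(ζ_p)` (cell `b2b-bsdres`, seat additive-p4)

HONEST FRAMING (cell `b2b-bsdres`, run/shared/lean/b2b/bsd-rank1-residual/, verbatim in every
file): the goal of the cell is to DELETE the COMBINATION-SHAPED residual classes of the
Birch–Swinnerton-Dyer formula for ALL analytic-rank `≤ 1` elliptic curves over `ℚ` — "full BSD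
formula for every rank `≤ 1` curve in class `C`" assembled STRICTLY from published theorems — so
that the rank-`≤ 1` remainder becomes exactly the CONSTRUCTION-SHAPED classes, which are TYPED
(missing-input `Prop`s), NOT attempted. This is not "finishing BSD". Seat additive-p4 (research route
on X3/X4); the labels of X3 and X4 are UNCHANGED by this file; nothing is booked here.

Theorems only (no `def`, no `sorry`, no named fact). The unit-row corollaries of
`XGordRankZeroCyclotomicPrimeFacts.lean` drop the term `ord_p ∏_w c_w(V_F)` (`F = ℚ(ζ_p)`) from the
left-hand side of the core inequality. On rows where `V` has split multiplicative primes `ℓ` with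
`p ∣ c_ℓ(V)` this term is what balances the books: e.g. the X3 pair `(1274n1, 7)` with twist
`V = 26b1` has `c(W) = c(V) = 7`, `#V(ℚ) = #V(F)_tors = 7`, all other branch values units, and
`∏_w c_w(V_F) = 49` (two primes of `F = ℚ(ζ₇)` above `2`, each of type `I₇`): the core inequality reads
`ord₇#Ш(V) + ord₇#Ш(W) + 2 + 2 ≤ 0 + 0 + 2 + 2 + 0`, i.e. `Ш(V)[7] = Ш(W)[7] = 0`. The corollaries
below therefore take the certificate in the form
`ord_p∏c(V) + ord_p∏c(W) + 2 ord_p#V(F) + [Néron-normalised other-branch term] ≤ 2(ord_p#V(ℚ) +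
ord_p#W(ℚ)) + ord_p∏_w c_w(V_F)` — every quantity computable per pair (Tate's algorithm over `F`,
torsion over `F`, modular symbols; census job of the seat) — and conclude `BSD(W,p) ∧ BSD(V,p)` on the
rows with `#Ш_an(V)`, `#Ш_an(W)` prime to `p`.
-/

noncomputable section

open scoped Classical MatrixGroups ModularForm

open CongruenceSubgroup WeierstrassCurve NumberField IsDedekindDomain
  Literature.NumberTheory.EllipticCurves Literature.NumberTheory.EllipticCurves.ModularForms
  Literature.NumberTheory.EllipticCurves.Rank1Residual
  Literature.NumberTheory.EllipticCurves.Rank1Residual.Typed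
  Literature.NumberTheory.GaloisRepresentations

namespace Summit.BirchSwinnertonDyer.Rank1Residual.Additive

section Cert

variable (p : ℕ) [hp : Fact p.Prime]
  (V : WeierstrassCurve ℚ) [V.IsElliptic] [V.IsGloballyMinimal]
  (W : WeierstrassCurve ℚ) [W.IsElliptic] [W.IsGloballyMinimal]

/-- **X3, certificate form: `BSD(W,p) ∧ BSD(V,p)`** for the ADDITIVE X3 pair `(W,p)` (`e = 2`,
`W[p]` reducible) and its good ordinary Eisenstein twist `(V,p)`, ranks `(0,0)`, `p` odd, from Wuthrich
2014 Thm. 16 (all branches, named fact), Greenberg 1999 Thm. 4.1 (named fact), modularity, GZK, the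
unit bits `p ∤ #Ш_an(V)·#Ш_an(W)` and ONE numerical certificate
`ord_p∏c(V) + ord_p∏c(W) + 2 ord_p#V(ℚ(ζ_p)) + [v(o) + m(ord_p ϖ + ord_p ϖ') − ord_p ϖ − ord_p ϖ_mid]
≤ 2(ord_p#V(ℚ) + ord_p#W(ℚ)) + ord_p∏_w c_w(V_{ℚ(ζ_p)})`. Nothing booked by this theorem.
[cite: Wuthrich2014, Thm. 16 (p. 397)] [cite: GreenbergLNM1716, Thm. 4.1 (p. 102)] -/
theorem X3GordCyclotomicPrime.bsdp_of_certificate_of_facts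
    (hW : Wuthrich2014.charIdeal_dvd_padicLFunction_cyclotomicPrime)
    (hGr : Greenberg1999.thm41_charValue_rankZero_numberField)
    (hGZK : rank_eq_analyticRank_of_analyticRank_le_one) (hmod : hasEntireLFunction_rat)
    (hp2 : p ≠ 2) (C : VariableChange ℚ) (hC : C • V.quadraticTwist ((-1 : ℚ) ^ (p / 2) * p) = W)
    (hord : IsOrdinaryAt V p) (hred : ¬ V.HasIrreducibleModPGaloisRep p) (hadd : Addv W p)
    (hrV : V.analyticRank = 0) (hrW : W.analyticRank = 0)
    {N : ℕ} [NeZero N] {f : CuspForm (Gamma0 N) 2} (hf : IsNewformOf V f)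
    (ϖ ϖ' : ℚ) (hϖ : (ϖ : ℝ) * V.realPeriodRat = plusPeriod f)
    (hϖ' : (ϖ' : ℝ) * V.imaginaryPeriodRat = minusPeriod f)
    (hO : (∏ i ∈ ((Finset.range (p - 1)).erase 0).erase (p / 2),
        PowerSeries.constantCoeff
          (if Even i then padicLFunctionBranch f ((unitRoot V p : ℤ_[p]) : ℚ_[p]) i
            else padicLFunctionMinusBranch f ((unitRoot V p : ℤ_[p]) : ℚ_[p]) i)) ≠ 0)
    (hcert : (padicValNat p V.tamagawaProduct : ℤ) + padicValNat p W.tamagawaProduct +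
        2 * padicValNat p (Nat.card (V.baseChange (CyclotomicField p ℚ)).toAffine.Point) +
        ((∏ i ∈ ((Finset.range (p - 1)).erase 0).erase (p / 2),
          PowerSeries.constantCoeff
            (if Even i then padicLFunctionBranch f ((unitRoot V p : ℤ_[p]) : ℚ_[p]) i
              else padicLFunctionMinusBranch f ((unitRoot V p : ℤ_[p]) : ℚ_[p]) i)).valuation +
          ((p / 2 : ℕ) : ℤ) * (padicValRat p ϖ + padicValRat p ϖ') - padicValRat p ϖ -
          (if p % 4 = 1 then padicValRat p ϖ else padicValRat p ϖ')) ≤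
        2 * (padicValNat p (Nat.card V.toAffine.Point) + padicValNat p (Nat.card W.toAffine.Point)) +
          padicValNat p (V.baseChange (CyclotomicField p ℚ)).tamagawaProduct)
    {qV qW : ℚ} (hqV : shaAn V = (qV : ℂ)) (hqW : shaAn W = (qW : ℂ))
    (hvV : padicValRat p qV = 0) (hvW : padicValRat p qW = 0) : BSDp W p ∧ BSDp V p := by
  obtain ⟨qV', qW', hqV', hqW', hle⟩ := X3GordCyclotomicPrime.exists_padicVal_shaOrder_add_le_of_facts
    p V W hW hGr hGZK hmod hp2 C hC hord hred hadd hrV hrW hf ϖ ϖ' hϖ hϖ' hO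
  have hqq : qV' = qV := by exact_mod_cast hqV'.symm.trans hqV
  have hqq' : qW' = qW := by exact_mod_cast hqW'.symm.trans hqW
  subst hqq hqq'
  rw [hvV, hvW] at hle
  have hV0 : (0 : ℤ) ≤ padicValNat p V.shaOrder := by positivity
  have hW0 : (0 : ℤ) ≤ padicValNat p W.shaOrder := by positivity
  have huW : MissingUpperBoundAt W p := ⟨qW', hqW', by rw [hvW]; linarith⟩
  have huV : MissingUpperBoundAt V p := ⟨qV', hqV', by rw [hvV]; linarith⟩
  exact ⟨bsdp_of_missingPPartAt W p hGZK (by rw [hrW]; exact zero_le_one)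
      (missingPPartAt_of_upper_of_shaAn_unit W p huW hqW' hvW),
    bsdp_of_missingPPartAt V p hGZK (by rw [hrV]; exact zero_le_one)
      (missingPPartAt_of_upper_of_shaAn_unit V p huV hqV' hvV)⟩

/-- **X4, certificate form: `BSD(W,p) ∧ BSD(V,p)`** for the ADDITIVE X4 pair `(W,p)` (`e = 2`,
`ρ̄_{W,p}` onto, `p ≥ 5`) and its good ordinary twist `(V,p)`, ranks `(0,0)`, from Kato 2004 Thm.
17.4 (3) (all branches, named fact), Greenberg 1999 Thm. 4.1 (named fact), modularity, GZK, the unit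
bits `p ∤ #Ш_an(V)·#Ш_an(W)` and the numerical certificate of
`X3GordCyclotomicPrime.bsdp_of_certificate_of_facts`. Nothing booked by this theorem.
[cite: Kato2004Asterisque, Thm. 17.4 (3) (p. 273)] [cite: GreenbergLNM1716, Thm. 4.1 (p. 102)] -/
theorem X4GordCyclotomicPrime.bsdp_of_certificate_of_facts
    (hK : Kato2004.charIdeal_dvd_padicLFunction_cyclotomicPrime_of_surjective)
    (hGr : Greenberg1999.thm41_charValue_rankZero_numberField)
    (hGZK : rank_eq_analyticRank_of_analyticRank_le_one) (hmod : hasEntireLFunction_rat)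
    (hp5 : 5 ≤ p) (C : VariableChange ℚ) (hC : C • V.quadraticTwist ((-1 : ℚ) ^ (p / 2) * p) = W)
    (hord : IsOrdinaryAt V p) (hsurj : Surj W p) (hadd : Addv W p)
    (hrV : V.analyticRank = 0) (hrW : W.analyticRank = 0)
    {N : ℕ} [NeZero N] {f : CuspForm (Gamma0 N) 2} (hf : IsNewformOf V f)
    (ϖ ϖ' : ℚ) (hϖ : (ϖ : ℝ) * V.realPeriodRat = plusPeriod f)
    (hϖ' : (ϖ' : ℝ) * V.imaginaryPeriodRat = minusPeriod f)
    (hO : (∏ i ∈ ((Finset.range (p - 1)).erase 0).erase (p / 2),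
        PowerSeries.constantCoeff
          (if Even i then padicLFunctionBranch f ((unitRoot V p : ℤ_[p]) : ℚ_[p]) i
            else padicLFunctionMinusBranch f ((unitRoot V p : ℤ_[p]) : ℚ_[p]) i)) ≠ 0)
    (hcert : (padicValNat p V.tamagawaProduct : ℤ) + padicValNat p W.tamagawaProduct +
        2 * padicValNat p (Nat.card (V.baseChange (CyclotomicField p ℚ)).toAffine.Point) +
        ((∏ i ∈ ((Finset.range (p - 1)).erase 0).erase (p / 2),
          PowerSeries.constantCoeff
            (if Even i then padicLFunctionBranch f ((unitRoot V p : ℤ_[p]) : ℚ_[p]) i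
              else padicLFunctionMinusBranch f ((unitRoot V p : ℤ_[p]) : ℚ_[p]) i)).valuation +
          ((p / 2 : ℕ) : ℤ) * (padicValRat p ϖ + padicValRat p ϖ') - padicValRat p ϖ -
          (if p % 4 = 1 then padicValRat p ϖ else padicValRat p ϖ')) ≤
        2 * (padicValNat p (Nat.card V.toAffine.Point) + padicValNat p (Nat.card W.toAffine.Point)) +
          padicValNat p (V.baseChange (CyclotomicField p ℚ)).tamagawaProduct)
    {qV qW : ℚ} (hqV : shaAn V = (qV : ℂ)) (hqW : shaAn W = (qW : ℂ))
    (hvV : padicValRat p qV = 0) (hvW : padicValRat p qW = 0) : BSDp W p ∧ BSDp V p := by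
  obtain ⟨qV', qW', hqV', hqW', hle⟩ := X4GordCyclotomicPrime.exists_padicVal_shaOrder_add_le_of_facts
    p V W hK hGr hGZK hmod hp5 C hC hord hsurj hadd hrV hrW hf ϖ ϖ' hϖ hϖ' hO
  have hqq : qV' = qV := by exact_mod_cast hqV'.symm.trans hqV
  have hqq' : qW' = qW := by exact_mod_cast hqW'.symm.trans hqW
  subst hqq hqq'
  rw [hvV, hvW] at hle
  have hV0 : (0 : ℤ) ≤ padicValNat p V.shaOrder := by positivity
  have hW0 : (0 : ℤ) ≤ padicValNat p W.shaOrder := by positivity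
  have huW : MissingUpperBoundAt W p := ⟨qW', hqW', by rw [hvW]; linarith⟩
  have huV : MissingUpperBoundAt V p := ⟨qV', hqV', by rw [hvV]; linarith⟩
  exact ⟨bsdp_of_missingPPartAt W p hGZK (by rw [hrW]; exact zero_le_one)
      (missingPPartAt_of_upper_of_shaAn_unit W p huW hqW' hvW),
    bsdp_of_missingPPartAt V p hGZK (by rw [hrV]; exact zero_le_one)
      (missingPPartAt_of_upper_of_shaAn_unit V p huV hqV' hvV)⟩

end Cert

end Summit.BirchSwinnertonDyer.Rank1Residual.Additive

end
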